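import Mathlib
import Summits.Ventures.PercRepro2.HCov
import Summits.Ventures.PercRepro2.A3Inactive
import Summits.Ventures.PercRepro2.EdgeCubic
import Summits.Ventures.PercRepro2.EdgeCubicAll
import Summits.Ventures.PercRepro2.RootEdgeBernSwap

/-!
# Row 2′CPOLAR is needed only at the edges of `a₃`: the one-edge Bernstein induction pinning
only the edges that touch the pinned-open reach of `a₃` (blind cell PercRepro2, p5 g15;
`proofs/P5-OEDGE.md` §14)

`HCov_of_bern` (EdgeCubicAll.lean) pins EVERY fractional edge and so consumes `0 ≤ B1 ∧ 0 ≤ B2` at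
every edge of every admissible weight vector. The same induction on the number of fractional edges
can pin only the fractional edges that TOUCH the pinned-open reach
`K(p) = {v ∣ a₃ ↔ v through the edges of weight 1}` of `a₃` (`pinnedReach`, `TouchesReach`): once no
fractional edge touches `K(p)`, every edge leaving `K(p)` has weight `0`, so on every configuration
of positive weight the cluster of `a₃` is `K(p)` (`conn_mem_pinnedReach`), and

* if a root lies in `K(p)`, the world `PD = {a₃ ∉ U}` is null, `D = D_o = 0` and `Gc = 0`
  (`Gc_eq_zero_of_root`);
* otherwise `a₃` is inactive almost surely (`InactiveAE`): the worlds `T`, `T′` are null and `PD = Q`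
  up to null sets, so `Gc = 2 P(Q) [S(bL, oH) + S(bH, oL)] ≥ 0` by BHK06 Thm 1.4 twice —
  the almost-sure twin of `A3Inactive.Gc_eq_of_a3Inactive` (`Gc_eq_of_inactiveAE`; both cases in
  `HCov_of_reach_pinned`).

Hence **`HCov_of_bern_a3`** and **`HCov_all_of_cpolarA3_all : CPolarA3_all R → HCov_all R`**: the crux
follows from row 2′CPOLAR at the fractional edges touching the pinned-open reach of `a₃` alone — in
graph language, at the edges incident to `a₃` in every contraction of the instance along weight-`1`
edges; the Bernstein positivity at edges away from `a₃` is never used (`cpolarA3_all_of_cpolar_all`: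
the hypothesis is weaker than `CPolar_all`). Since row 2′CPOLAR is a theorem at every root edge at
`a₃` (`RootEdge.B2_nonneg_of_isRootEdge`; `B1_nonneg_of_isRootEdge` given (HCOV) at `p[e↦0]`), the
induction takes those edges for free: **`HCov_of_bern_a3_nonroot`** /
**`HCov_all_of_cpolarA3NR_all : CPolarA3NR_all R → HCov_all R`** ask for the Bernstein positivity only
at the fractional NON-root edges touching the reach.
-/

namespace Summit.Ventures.PercRepro2

open UnionCluster

namespace CovForm

namespace CPolarA3

/-! ## Null events and the almost-surely inactive `a₃` -/

section Null

variable {V : Type*} {E : Type*} [Fintype E] [DecidableEq E] [DecidableEq V] {R : Type*}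
  [Field R] [LinearOrder R]

omit [LinearOrder R] in
/-- An event on which the weight vanishes is null. -/
lemma prob_eq_zero_of_weight_eq_zero (p : E → R) (A : Set (Config E))
    (h : ∀ ω ∈ A, weight p ω = 0) : prob p A = 0 := by
  unfold prob
  refine Finset.sum_eq_zero fun ω _ => ?_
  by_cases hω : ω ∈ A
  · rw [Set.indicator_of_mem hω, h ω hω]
  · rw [Set.indicator_of_notMem hω]

/-- `a₃` is inactive ALMOST SURELY: on every configuration of positive weight it meets no root. -/
def InactiveAE (p : E → R) (ends : E → Sym2 V) (a₁ a₂ a₃ : V) : Prop :=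
  ∀ ω : Config E, weight p ω ≠ 0 → ¬ Conn ends ω a₁ a₃ ∧ ¬ Conn ends ω a₂ a₃

variable {p : E → R} {ends : E → Sym2 V} {a₁ a₂ a₃ : V}

omit [DecidableEq V] in
/-- `T ∩ X` is null for an almost-surely inactive `a₃`. -/
lemma prob_T_inter_eq_zero (h : InactiveAE p ends a₁ a₂ a₃) (X : Set (Config E)) :
    prob p (TEvent ends a₁ a₂ a₃ ∩ X) = 0 := by
  refine prob_eq_zero_of_weight_eq_zero p _ fun ω hω => ?_
  by_contra hw
  have h23 : Conn ends ω a₂ a₃ := by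
    have := hω.1
    simp only [TEvent, Set.mem_inter_iff, Set.mem_compl_iff, mem_connEvent] at this
    exact this.2
  exact (h ω hw).2 h23

omit [DecidableEq V] in
/-- `T′ ∩ X` is null for an almost-surely inactive `a₃`. -/
lemma prob_T'_inter_eq_zero (h : InactiveAE p ends a₁ a₂ a₃) (X : Set (Config E)) :
    prob p (TEvent ends a₂ a₁ a₃ ∩ X) = 0 := by
  refine prob_eq_zero_of_weight_eq_zero p _ fun ω hω => ?_
  by_contra hw
  have h13 : Conn ends ω a₁ a₃ := by
    have := hω.1
    simp only [TEvent, Set.mem_inter_iff, Set.mem_compl_iff, mem_connEvent] at this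
    exact this.2
  exact (h ω hw).1 h13

omit [DecidableEq V] in
/-- `T` is null for an almost-surely inactive `a₃`. -/
lemma prob_T_eq_zero (h : InactiveAE p ends a₁ a₂ a₃) : prob p (TEvent ends a₁ a₂ a₃) = 0 := by
  have := prob_T_inter_eq_zero h Set.univ
  simpa only [Set.inter_univ] using this

omit [DecidableEq V] in
/-- `T′` is null for an almost-surely inactive `a₃`. -/
lemma prob_T'_eq_zero (h : InactiveAE p ends a₁ a₂ a₃) : prob p (TEvent ends a₂ a₁ a₃) = 0 := by
  have := prob_T'_inter_eq_zero h Set.univ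
  simpa only [Set.inter_univ] using this

/-- `P(PD ∩ X) = P(Q ∩ X)` for an almost-surely inactive `a₃` (`Qsplit` with null `T`, `T′`). -/
lemma prob_PD_inter_eq (h : InactiveAE p ends a₁ a₂ a₃) (X : Set (Config E)) :
    prob p (PDEvent ends a₁ a₂ a₃ ∩ X) = prob p (avoidAll ends a₂ {a₁} ∩ X) := by
  rw [Qsplit p ends a₁ a₂ a₃ X, prob_T_inter_eq_zero h, prob_T'_inter_eq_zero h]
  ring

/-- `D = P(Q)` for an almost-surely inactive `a₃`. -/
lemma prob_PD_eq (h : InactiveAE p ends a₁ a₂ a₃) :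
    prob p (PDEvent ends a₁ a₂ a₃) = prob p (avoidAll ends a₂ {a₁}) := by
  have := prob_PD_inter_eq h Set.univ
  simpa only [Set.inter_univ] using this

/-- **`Gc` with an almost-surely inactive `a₃`** is twice `P(Q)` times the sum of the two
cross-cluster slacks — the almost-sure twin of `A3Inactive.Gc_eq_of_a3Inactive`. -/
theorem Gc_eq_of_inactiveAE [IsStrictOrderedRing R] (o b : V) (h : InactiveAE p ends a₁ a₂ a₃) :
    Gc p ends o a₁ a₂ a₃ b =
      2 * prob p (avoidAll ends a₂ {a₁}) *
        ((prob p (avoidAll ends a₂ {a₁} ∩ connEvent ends a₁ b) *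
            prob p (avoidAll ends a₂ {a₁} ∩ connEvent ends a₂ o) -
          prob p (avoidAll ends a₂ {a₁}) *
            prob p (avoidAll ends a₂ {a₁} ∩ (connEvent ends a₂ o ∩ connEvent ends a₁ b))) +
         (prob p (avoidAll ends a₂ {a₁} ∩ connEvent ends a₂ b) *
            prob p (avoidAll ends a₂ {a₁} ∩ connEvent ends a₁ o) -
          prob p (avoidAll ends a₂ {a₁}) *
            prob p (avoidAll ends a₂ {a₁} ∩ (connEvent ends a₁ o ∩ connEvent ends a₂ b)))) := by
  unfold Gc DEF EQbo EQb3 EQb3o EQo EQ3 EQ3o PDb PDbo Do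
  rw [gap_eq_Q]
  simp only [prob_T_inter_eq_zero h, prob_T'_inter_eq_zero h, prob_T_eq_zero h, prob_T'_eq_zero h,
    prob_PD_inter_eq h, prob_PD_eq h]
  ring

omit [DecidableEq V] in
/-- `PD ∩ X` is null when `a₃` meets a root on every configuration of positive weight. -/
lemma prob_PD_inter_eq_zero_of_root
    (h : ∀ ω : Config E, weight p ω ≠ 0 → Conn ends ω a₃ a₁ ∨ Conn ends ω a₃ a₂)
    (X : Set (Config E)) : prob p (PDEvent ends a₁ a₂ a₃ ∩ X) = 0 := by
  refine prob_eq_zero_of_weight_eq_zero p _ fun ω hω => ?_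
  by_contra hw
  have hPD := hω.1
  simp only [PDEvent, Dtilde, Set.mem_inter_iff, Set.mem_compl_iff, mem_inU] at hPD
  exact hPD.2 (h ω hw)

omit [DecidableEq V] in
/-- `Gc = 0` when `a₃` meets a root on every configuration of positive weight (`D = D_o = 0`). -/
theorem Gc_eq_zero_of_root (o b : V)
    (h : ∀ ω : Config E, weight p ω ≠ 0 → Conn ends ω a₃ a₁ ∨ Conn ends ω a₃ a₂) :
    Gc p ends o a₁ a₂ a₃ b = 0 := by
  have hD : prob p (PDEvent ends a₁ a₂ a₃) = 0 := by
    have := prob_PD_inter_eq_zero_of_root h Set.univ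
    simpa only [Set.inter_univ] using this
  unfold Gc DEF Do
  simp only [prob_PD_inter_eq_zero_of_root h, hD]
  ring

end Null

/-! ## The pinned-open reach of `a₃` -/

section Reach

variable {V : Type*} {E : Type*} [Fintype E] [DecidableEq E] {R : Type*} [Field R]
  [LinearOrder R]

/-- The pinned-open reach of `a₃`: the vertices joined to `a₃` through edges of weight `1`. -/
def pinnedReach (p : E → R) (ends : E → Sym2 V) (a₃ : V) : Set V :=
  {v | Conn ends (pinnedConfig p) a₃ v}

/-- An edge touching the pinned-open reach of `a₃`. -/
def TouchesReach (p : E → R) (ends : E → Sym2 V) (a₃ : V) (e : E) : Prop :=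
  ∃ x ∈ ends e, x ∈ pinnedReach p ends a₃

variable {p : E → R} {ends : E → Sym2 V} {a₃ : V}

omit [Fintype E] [DecidableEq E] in
/-- `a₃` lies in its own reach. -/
lemma self_mem_pinnedReach : a₃ ∈ pinnedReach p ends a₃ := conn_refl ends _ a₃

omit [LinearOrder R] in
/-- On a configuration of positive weight every edge of weight `1` is open. -/
lemma open_of_weight_ne_zero {ω : Config E} (hw : weight p ω ≠ 0) {e : E} (he : p e = 1) :
    ω e = true := by
  by_contra hc
  have hf : ω e = false := by simpa using hc
  apply hw
  rw [weight_eq_mul_edgeFactor p ω e, hf, he]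
  simp

omit [LinearOrder R] in
/-- On a configuration of positive weight every edge of weight `0` is closed. -/
lemma closed_of_weight_ne_zero {ω : Config E} (hw : weight p ω ≠ 0) {e : E} (he : p e = 0) :
    ω e = false := by
  by_contra hc
  have ht : ω e = true := by simpa using hc
  apply hw
  rw [weight_eq_mul_edgeFactor p ω e, ht, he]
  simp

/-- A configuration of positive weight dominates the pinned configuration. -/
lemma pinnedConfig_le_of_weight_ne_zero {ω : Config E} (hw : weight p ω ≠ 0) :
    pinnedConfig p ≤ ω := by
  intro e
  by_cases h1 : p e = 1
  · rw [open_of_weight_ne_zero hw h1]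
    exact Bool.le_true _
  · have h0 : pinnedConfig p e = false := by
      unfold pinnedConfig
      rw [decide_eq_false_iff_not]
      exact h1
    rw [h0]
    exact Bool.false_le _

/-- A vertex of the reach is joined to `a₃` on every configuration of positive weight. -/
lemma conn_of_mem_pinnedReach {ω : Config E} (hw : weight p ω ≠ 0) {v : V}
    (hv : v ∈ pinnedReach p ends a₃) : Conn ends ω a₃ v :=
  conn_mono (pinnedConfig_le_of_weight_ne_zero hw) hv

/-- **The cluster of `a₃` is its pinned-open reach** once no fractional edge touches the reach:
on every configuration of positive weight, everything joined to `a₃` lies in `pinnedReach`. -/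
lemma conn_mem_pinnedReach (hfr : ∀ e ∈ fracEdges p, ¬ TouchesReach p ends a₃ e)
    {ω : Config E} (hw : weight p ω ≠ 0) {v : V} (hv : Conn ends ω a₃ v) :
    v ∈ pinnedReach p ends a₃ := by
  refine mem_of_conn_of_closed (ends := ends) (ω := ω) ?_ self_mem_pinnedReach hv
  intro x hx y hxy
  obtain ⟨_, e, he, hends⟩ := openGraph_adj.1 hxy
  have hxe : x ∈ ends e := by rw [hends]; exact Sym2.mem_mk_left x y
  by_cases h1 : p e = 1
  · -- a weight-`1` edge stays inside the reach
    have hadj : OpenAdj ends (pinnedConfig p) x y := by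
      refine ⟨e, ?_, hends⟩
      unfold pinnedConfig
      rw [decide_eq_true_iff]
      exact h1
    exact conn_trans hx (conn_of_openAdj hadj)
  · by_cases h0 : p e = 0
    · -- a weight-`0` edge is closed on a configuration of positive weight
      exact absurd he (by rw [closed_of_weight_ne_zero hw h0]; exact Bool.false_ne_true)
    · -- a fractional edge touching the reach is excluded by hypothesis
      have hef : e ∈ fracEdges p := by simp [fracEdges, h0, h1]
      exact absurd ⟨x, hxe, hx⟩ (hfr e hef)

end Reach

/-! ## (HCOV) once every edge touching the reach is pinned -/

section Base

variable {V : Type*} {E : Type*} [Fintype V] [DecidableEq V] [Fintype E] [DecidableEq E]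
  {R : Type*} [Field R] [LinearOrder R] [IsStrictOrderedRing R]

/-- **(HCOV) when no fractional edge touches the pinned-open reach of `a₃`**: a root in the reach
makes `PD` null (`Gc = 0`); otherwise `a₃` is almost surely inactive and `Gc` is the BHK slack. -/
theorem HCov_of_reach_pinned (p : E → R) (hp : IsProbVec p) (ends : E → Sym2 V)
    (o a₁ a₂ a₃ b : V) (hfr : ∀ e ∈ fracEdges p, ¬ TouchesReach p ends a₃ e) :
    HCov p ends o a₁ a₂ a₃ b := by
  unfold HCov
  by_cases hroot : a₁ ∈ pinnedReach p ends a₃ ∨ a₂ ∈ pinnedReach p ends a₃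
  · rw [Gc_eq_zero_of_root o b]
    intro ω hw
    rcases hroot with h | h
    · exact Or.inl (conn_of_mem_pinnedReach hw h)
    · exact Or.inr (conn_of_mem_pinnedReach hw h)
  · rw [not_or] at hroot
    have hin : InactiveAE p ends a₁ a₂ a₃ := by
      intro ω hw
      exact ⟨fun h => hroot.1 (conn_mem_pinnedReach hfr hw (conn_symm h)),
        fun h => hroot.2 (conn_mem_pinnedReach hfr hw (conn_symm h))⟩
    rw [Gc_eq_of_inactiveAE o b hin]
    have hQ := prob_nonneg hp (avoidAll ends a₂ {a₁})
    have h1 := A3Inactive.bLoH_mul_Q_le p hp ends o a₁ a₂ b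
    have h2 := A3Inactive.bHoL_mul_Q_le p hp ends o a₁ a₂ b
    have hS : 0 ≤ (prob p (avoidAll ends a₂ {a₁} ∩ connEvent ends a₁ b) *
              prob p (avoidAll ends a₂ {a₁} ∩ connEvent ends a₂ o) -
            prob p (avoidAll ends a₂ {a₁}) *
              prob p (avoidAll ends a₂ {a₁} ∩ (connEvent ends a₂ o ∩ connEvent ends a₁ b))) +
           (prob p (avoidAll ends a₂ {a₁} ∩ connEvent ends a₂ b) *
              prob p (avoidAll ends a₂ {a₁} ∩ connEvent ends a₁ o) -
            prob p (avoidAll ends a₂ {a₁}) *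
              prob p (avoidAll ends a₂ {a₁} ∩ (connEvent ends a₁ o ∩ connEvent ends a₂ b))) := by
      linarith
    exact mul_nonneg (mul_nonneg (by norm_num) hQ) hS

end Base

/-! ## The induction pinning only the edges that touch the reach -/

section Induction

variable {V : Type*} {E : Type*} [Fintype V] [DecidableEq V] [Fintype E] [DecidableEq E]
  {R : Type*} [Field R] [LinearOrder R] [IsStrictOrderedRing R]

open EdgeLine

/-- **(HCOV) from the one-edge Bernstein positivity at the fractional NON-root edges touching the
pinned-open reach of `a₃`**, by induction on the number of fractional edges: a fractional edge touching
the reach is pinned through `EdgeLine.HCov_of_update_zero_of_bern` — at a root edge at `a₃` with the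
root-edge theorems (`0 ≤ B2` unconditional, `0 ≤ B1` from (HCOV) at `p[e↦0]`, which the induction
supplies), elsewhere with the hypothesis; when none is left, `HCov_of_reach_pinned` closes. -/
theorem HCov_of_bern_a3_nonroot (ends : E → Sym2 V) (o a₁ a₂ a₃ b : V)
    (hB : ∀ q : E → R, IsProbVec q → ∀ e, q e ≠ 0 → q e ≠ 1 → TouchesReach q ends a₃ e →
      ¬ RootEdge.IsRootEdge ends a₁ a₂ a₃ e →
      0 ≤ B1 q ends o a₁ a₂ a₃ b e ∧ 0 ≤ B2 q ends o a₁ a₂ a₃ b e)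
    (p : E → R) (hp : IsProbVec p) : HCov p ends o a₁ a₂ a₃ b := by
  generalize hn : (fracEdges p).card = n
  induction n using Nat.strong_induction_on generalizing p with
  | _ n ih =>
    by_cases h : ∃ e ∈ fracEdges p, TouchesReach p ends a₃ e
    · obtain ⟨e, he, ht⟩ := h
      have hlt : ((fracEdges p).erase e).card < n := by
        rw [← hn]; exact Finset.card_erase_lt_of_mem he
      have hp₀ : IsProbVec (Function.update p e 0) := hp.update e le_rfl zero_le_one
      have hp₁ : IsProbVec (Function.update p e 1) := hp.update e zero_le_one le_rfl
      have h₀ : HCov (Function.update p e 0) ends o a₁ a₂ a₃ b :=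
        ih _ hlt (Function.update p e 0) hp₀ (by rw [fracEdges_update p e 0 (Or.inl rfl)])
      have h₁ : HCov (Function.update p e 1) ends o a₁ a₂ a₃ b :=
        ih _ hlt (Function.update p e 1) hp₁ (by rw [fracEdges_update p e 1 (Or.inr rfl)])
      have hfe : p e ≠ 0 ∧ p e ≠ 1 := by simpa [fracEdges] using he
      by_cases hr : RootEdge.IsRootEdge ends a₁ a₂ a₃ e
      · exact HCov_of_update_zero_of_bern p hp ends o a₁ a₂ a₃ b e h₀ h₁
          (RootEdge.B1_nonneg_of_isRootEdge p hp ends o a₁ a₂ a₃ b e hr h₀)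
          (RootEdge.B2_nonneg_of_isRootEdge p hp ends o a₁ a₂ a₃ b e hr)
      · exact HCov_of_update_zero_of_bern p hp ends o a₁ a₂ a₃ b e h₀ h₁
          (hB p hp e hfe.1 hfe.2 ht hr).1 (hB p hp e hfe.1 hfe.2 ht hr).2
    · simp only [not_exists, not_and] at h
      exact HCov_of_reach_pinned p hp ends o a₁ a₂ a₃ b h

/-- **(HCOV) from the one-edge Bernstein positivity at the fractional edges touching the
pinned-open reach of `a₃`** (every admissible weight vector of the graph). -/
theorem HCov_of_bern_a3 (ends : E → Sym2 V) (o a₁ a₂ a₃ b : V)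
    (hB : ∀ q : E → R, IsProbVec q → ∀ e, q e ≠ 0 → q e ≠ 1 → TouchesReach q ends a₃ e →
      0 ≤ B1 q ends o a₁ a₂ a₃ b e ∧ 0 ≤ B2 q ends o a₁ a₂ a₃ b e)
    (p : E → R) (hp : IsProbVec p) : HCov p ends o a₁ a₂ a₃ b :=
  HCov_of_bern_a3_nonroot ends o a₁ a₂ a₃ b (fun q hq e h0 h1 ht _ => hB q hq e h0 h1 ht) p hp

end Induction

/-! ## Over every finite graph -/

section Closure

variable (R : Type*) [Field R] [LinearOrder R] [IsStrictOrderedRing R]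

/-- **Row 2′CPOLAR at the edges of `a₃` only**: `0 ≤ B1` and `0 ≤ B2` at every FRACTIONAL edge
touching the pinned-open reach of `a₃`, for every admissible weight vector on every finite graph
(the binders of `HCov_all`). In graph language: the one-edge Bernstein positivity at the edges
incident to `a₃` in every contraction of the instance along weight-`1` edges. -/
def CPolarA3_all : Prop :=
  ∀ (V E : Type) [Fintype V] [DecidableEq V] [Fintype E] [DecidableEq E]
    (ends : E → Sym2 V) (p : E → R), IsProbVec p →
    ∀ o a₁ a₂ a₃ b : V, a₁ ≠ a₂ → a₁ ≠ a₃ → a₂ ≠ a₃ → o ≠ a₁ → o ≠ a₂ → o ≠ a₃ → o ≠ b →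
      b ≠ a₁ → b ≠ a₂ → b ≠ a₃ → ∀ e, p e ≠ 0 → p e ≠ 1 → TouchesReach p ends a₃ e →
        0 ≤ EdgeLine.B1 p ends o a₁ a₂ a₃ b e ∧ 0 ≤ EdgeLine.B2 p ends o a₁ a₂ a₃ b e

omit [IsStrictOrderedRing R] in
/-- `CPolarA3_all` is weaker than `CPolar_all`: it asks for fewer edge lines. -/
theorem cpolarA3_all_of_cpolar_all (h : CPolar_all R) : CPolarA3_all R := by
  intro V E _ _ _ _ ends p hp o a₁ a₂ a₃ b h1 h2 h3 h4 h5 h6 h7 h8 h9 h10 e _ _ _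
  exact h V E ends p hp o a₁ a₂ a₃ b h1 h2 h3 h4 h5 h6 h7 h8 h9 h10 e

/-- **Row 2′CPOLAR at the edges of `a₃` implies the crux**: `CPolarA3_all R → HCov_all R`. -/
theorem HCov_all_of_cpolarA3_all (h : CPolarA3_all R) : HCov_all R := by
  intro V E _ _ _ _ ends p hp o a₁ a₂ a₃ b h1 h2 h3 h4 h5 h6 h7 h8 h9 h10
  exact HCov_of_bern_a3 ends o a₁ a₂ a₃ b
    (fun q hq e h0 h1' ht =>
      h V E ends q hq o a₁ a₂ a₃ b h1 h2 h3 h4 h5 h6 h7 h8 h9 h10 e h0 h1' ht) p hp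

/-- **Row 2′CPOLAR at the NON-root edges of `a₃` only**: the binders of `CPolarA3_all` with the root
edges at `a₃` excluded (they are the theorems of RootEdgeBern / RootEdgeBernSwap). -/
def CPolarA3NR_all : Prop :=
  ∀ (V E : Type) [Fintype V] [DecidableEq V] [Fintype E] [DecidableEq E]
    (ends : E → Sym2 V) (p : E → R), IsProbVec p →
    ∀ o a₁ a₂ a₃ b : V, a₁ ≠ a₂ → a₁ ≠ a₃ → a₂ ≠ a₃ → o ≠ a₁ → o ≠ a₂ → o ≠ a₃ → o ≠ b →
      b ≠ a₁ → b ≠ a₂ → b ≠ a₃ → ∀ e, p e ≠ 0 → p e ≠ 1 → TouchesReach p ends a₃ e →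
        ¬ RootEdge.IsRootEdge ends a₁ a₂ a₃ e →
        0 ≤ EdgeLine.B1 p ends o a₁ a₂ a₃ b e ∧ 0 ≤ EdgeLine.B2 p ends o a₁ a₂ a₃ b e

/-- **Row 2′CPOLAR at the non-root edges of `a₃` implies the crux**: `CPolarA3NR_all R → HCov_all R`. -/
theorem HCov_all_of_cpolarA3NR_all (h : CPolarA3NR_all R) : HCov_all R := by
  intro V E _ _ _ _ ends p hp o a₁ a₂ a₃ b h1 h2 h3 h4 h5 h6 h7 h8 h9 h10
  exact HCov_of_bern_a3_nonroot ends o a₁ a₂ a₃ b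
    (fun q hq e h0 h1' ht hr =>
      h V E ends q hq o a₁ a₂ a₃ b h1 h2 h3 h4 h5 h6 h7 h8 h9 h10 e h0 h1' ht hr) p hp

end Closure

end CPolarA3

end CovForm

end Summit.Ventures.PercRepro2
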